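import Mathlib
import HarnessLib
import Summits.NavierStokesRegularity.NavierStokesRegularity.Theorems.PoloidalWindowDoorLrcModEntireQ4TimeWebPackage
import Summits.NavierStokesRegularity.NavierStokesRegularity.Theorems.PoloidalWindowDoorLrcModEntireQ4SonicHotSheetTimeSplit

/-!
# Route `PoloidalWindowDoor`, item `LrcModEntire` (stmt-NavierStokesRegularity-20428), cell (Q4-sonic), slot `stub_Q4sonicLineNeg` —
# HUYGENS IN TIME FOR THE HULL ELEMENT: on the straight sonic sheet with `μ(−1,0) ≠ 0` the web speed splits, `∂_τn₀(0,s,z) = α(s) + β(z)`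

Cell ns-regularity-ideate, helper seat ns-k2-port-2 g8 under the LEAD of item 20428 (ns-poloidal-K2-p3 g17); `--supports stmt-NavierStokesRegularity-20428 --as helper`.
The class wiring of `…Q4SonicHotSheetTimeSplit.webSpeed_split` (memo `Cruxes/LrcModEntire/HOT-SHEET-port2g8.md` §3(b)): the space–time web package
`…Q4TimeWebPackage.time_web_package_line` supplies the jointly smooth web function `n₀(τ,s,z)`, the Huygens identity at every nearby time and the parallel webs
at `τ = 0` (`n₀(0,s,z) = d(z)`); the SONIC literal (`R(0,·)` affine) makes the sheet characteristic, `d′(z)² = −μ(−1,z)`, and the slot literal `μ(−1,0) ≠ 0`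
(hence `< 0`, `…TwistingTHSlopeSign.slopeFunction_nonpos`) gives `d′ ≠ 0` near `z = 0`.  Hence:

* `differentiableAt_sliceHessian_time` (class-free) — `τ ↦ D²(F τ)(g τ)[a,b]` is differentiable for `F` jointly smooth and `g` differentiable;
* ★★ `sonic_webSpeed_split` — hypotheses = those of `line_web_package` + sonic + `μ(−1,0) ≠ 0`: there are `δ″ > 0` and the space–time web function `n₀` of the
  package such that **`V(s,z) − V(s′,z) = V(s,z₀) − V(s′,z₀)`** for all `s, s′` and `|z|,|z₀| < δ″`, `V(s,z) := ∂_τn₀(0,s,z)` (`= fderiv ℝ n₀ (0,s,z) (1,0,0)`):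
  the normal speed of the web at `τ = 0` is `α(s) + β(z)`.  The webs stay parallel to first order in `τ` iff `α′ ≡ 0` — NOT forced by the tree (memo §3(c),
  refuter1 DUTY-C6).

WHAT THIS IS NOT: not a claim about Navier–Stokes regularity — structure of the hypothetical hot null sheet of the research slot `stub_Q4sonicLineNeg` (registry
twist_split v11); no stub is closed here; items 20428 / 19708 / 27893 OPEN.
-/

noncomputable section

set_option linter.dupNamespace false
set_option linter.style.longLine false

namespace Summit.NavierStokesRegularity.NavierStokesRegularity.Theorems.PoloidalWindowDoorLrcModEntireQ4SonicTimeSplitClass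

open Set Function Filter Topology Metric
open scoped RealInnerProductSpace InnerProductSpace Laplacian ContDiff
open Literature.Analysis Literature.Analysis.FluidPDE Literature.Analysis.UnboundedOperators
open Summit.NavierStokesRegularity.NavierStokesRegularity.Theorems
open Summit.NavierStokesRegularity.NavierStokesRegularity.Theorems.PoloidalWindowDoorLrcModEntireSheetFlattenTools
open Summit.NavierStokesRegularity.NavierStokesRegularity.Theorems.PoloidalWindowDoorLrcModEntireQ4LineTools
open Summit.NavierStokesRegularity.NavierStokesRegularity.Theorems.PoloidalWindowDoorLrcModEntireQ4LineWeb
open Summit.NavierStokesRegularity.NavierStokesRegularity.Theorems.PoloidalWindowDoorLrcModEntireRidgeClassConstants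
open Summit.NavierStokesRegularity.NavierStokesRegularity.Theorems.PoloidalWindowDoorLrcModEntireTwistingTHSlopeSign
open Summit.NavierStokesRegularity.NavierStokesRegularity.Theorems.PoloidalWindowDoorLrcModEntireTwistingTHFlatRidgeMixedPin
open Summit.NavierStokesRegularity.NavierStokesRegularity.Theorems.PoloidalWindowDoorLrcModEntireQ4TimeWebFunction
open Summit.NavierStokesRegularity.NavierStokesRegularity.Theorems.PoloidalWindowDoorLrcModEntireQ4TimeWebPackage
open Summit.NavierStokesRegularity.NavierStokesRegularity.Theorems.PoloidalWindowDoorLrcModEntireQ4SonicHotSheetTimeSplit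

/-! ### A class-free tool: slice Hessians along a curve are differentiable IN TIME -/

/-- **`τ ↦ D²(F τ)(g τ)[a,b]` is differentiable** at `τ₀ ∈ T` for `F` jointly smooth on the open time set `T` and `g : ℝ → ℝ³` differentiable at `τ₀`
(the slice Hessian is the spatial block of the space–time Hessian near `τ₀`). -/
theorem differentiableAt_sliceHessian_time {F : ℝ → EuclideanSpace ℝ (Fin 3) → ℝ} {T : Set ℝ} (hT : IsOpen T) (hF : IsSmoothSpaceTimeOn T F)
    {τ₀ : ℝ} (hτ₀ : τ₀ ∈ T) {g : ℝ → EuclideanSpace ℝ (Fin 3)} (hg : DifferentiableAt ℝ g τ₀) (a b : EuclideanSpace ℝ (Fin 3)) :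
    DifferentiableAt ℝ (fun τ : ℝ => fderiv ℝ (fderiv ℝ (F τ)) (g τ) a b) τ₀ := by
  have hD2 : ContDiffOn ℝ ∞ (fderiv ℝ (fderiv ℝ (uncurry F))) (T ×ˢ (univ : Set (EuclideanSpace ℝ (Fin 3)))) :=
    (hF.fderiv_of_isOpen (hT.prod isOpen_univ) (m := ∞) le_rfl).fderiv_of_isOpen (hT.prod isOpen_univ) (m := ∞) le_rfl
  have hmem : ((τ₀, g τ₀) : ℝ × EuclideanSpace ℝ (Fin 3)) ∈ T ×ˢ (univ : Set (EuclideanSpace ℝ (Fin 3))) := ⟨hτ₀, mem_univ _⟩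
  have hl : DifferentiableAt ℝ (fun τ : ℝ => ((τ, g τ) : ℝ × EuclideanSpace ℝ (Fin 3))) τ₀ := by
    have h : DifferentiableAt ℝ (fun τ : ℝ => τ) τ₀ := differentiableAt_id
    exact h.prodMk hg
  have hB : DifferentiableAt ℝ (fun τ : ℝ => fderiv ℝ (fderiv ℝ (uncurry F)) (τ, g τ)) τ₀ :=
    DifferentiableAt.comp (g := fderiv ℝ (fderiv ℝ (uncurry F))) τ₀
      ((hD2.contDiffAt ((hT.prod isOpen_univ).mem_nhds hmem)).differentiableAt (by simp)) hl
  have hBab : DifferentiableAt ℝ (fun τ : ℝ => fderiv ℝ (fderiv ℝ (uncurry F)) (τ, g τ) ((0 : ℝ), a) ((0 : ℝ), b)) τ₀ :=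
    (hB.clm_apply (differentiableAt_const _)).clm_apply (differentiableAt_const _)
  refine hBab.congr_of_eventuallyEq ?_
  filter_upwards [hT.mem_nhds hτ₀] with τ hτ
  have hF2 : ContDiff ℝ 2 (F τ) := (hF.contDiff_slice hτ).of_le (by exact WithTop.coe_le_coe.2 le_top)
  rw [← nested_eq_fderiv_fderiv hF2, fderiv_fderiv_slice_apply hF hT hτ]

/-! ### The hull element: the web speed splits on the straight sonic sheet -/

variable {C : ℝ} {U : ℝ → EuclideanSpace ℝ (Fin 3) → EuclideanSpace ℝ (Fin 3)} {Γ νΓ : ℝ → EuclideanSpace ℝ (Fin 3)} {R μ : ℝ → ℝ → ℝ}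
  {σ κ r δ ρ : ℝ}

/-- ★★ **HUYGENS IN TIME FOR THE HULL ELEMENT (straight sonic sheet, `μ(−1,0) ≠ 0`).**  Under the hypotheses of `…Q4WebPackage.line_web_package` plus the
SONIC literal and `μ(−1,0) ≠ 0`, the space–time web function `n₀` of `…Q4TimeWebPackage.time_web_package_line` has a web speed `V(s,z) = ∂_τn₀(0,s,z)` with
`V(s,z) − V(s′,z)` independent of `z` on a window: `V = α(s) + β(z)`. -/
theorem sonic_webSpeed_split
    (hUrate : HasTypeITimeDecay C U) (hUcont : ContinuousOn (uncurry U) (Iio (0 : ℝ) ×ˢ univ))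
    (hUmild : ∀ s t : ℝ, s < t → t < 0 → ∀ x, U t x = heatExtension (U s) (t - s) x - oseenDuhamel 1 s U U t x)
    (hUdiv : ∀ t < 0, VectorCalculus.IsDivFree (U t))
    (hUpol : ∀ s < 0, ∀ q, ⟪curl (U s) q, EuclideanSpace.single 2 1⟫_ℝ = 0)
    (hUne : U (-1) 0 2 ≠ 0) (hUhotbd : ∀ t < 0, ∀ x, Real.sqrt (-t) * |U t x 2| ≤ |U (-1) 0 2|)
    (hσ : σ = 1 ∨ σ = -1) (hσN : σ * U (-1) 0 2 = |U (-1) 0 2|) (hκ : 0 < κ)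
    (hΓ0 : Γ 0 = 0) (hΓ2 : ∀ s, Γ s 2 = 0) (hΓunit : ∀ s, ‖deriv Γ s‖ = 1) (hΓhot : ∀ s, U (-1) (Γ s) 2 = U (-1) 0 2)
    (hν : ∀ s, νΓ s = WithLp.toLp 2 ![-(deriv Γ s 1), deriv Γ s 0, 0])
    (hΓcurv : ∀ s, κ ≤ -(fderiv ℝ (fderiv ℝ (fun y => σ * U (-1) y 2)) (Γ s) (νΓ s) (νΓ s)))
    (hr : 0 < r) (hδ : 0 < δ)
    (hconc : ∀ τ z : ℝ, |τ| < δ → |z| < δ → ∀ s : ℝ, ∀ n ∈ Ioo (-r) r,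
      fderiv ℝ (fderiv ℝ (fun y => σ * U (-1 + τ) y 2)) (Γ s + n • νΓ s + z • EuclideanSpace.single 2 (1 : ℝ)) (νΓ s) (νΓ s) < 0)
    (hweb : ∀ τ₀ z₀ : ℝ, |τ₀| < δ → |z₀| < δ → ∀ s₀ : ℝ, ∃ n₀ ∈ Ioo (-r) r,
      σ * U (-1 + τ₀) (Γ s₀ + n₀ • νΓ s₀ + z₀ • EuclideanSpace.single 2 (1 : ℝ)) 2 = R τ₀ z₀ ∧
      (∀ n ∈ Icc (-r) r, n ≠ n₀ → σ * U (-1 + τ₀) (Γ s₀ + n • νΓ s₀ + z₀ • EuclideanSpace.single 2 (1 : ℝ)) 2 < R τ₀ z₀) ∧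
      DifferentiableAt ℝ (uncurry R) (τ₀, z₀) ∧
      fderiv ℝ (uncurry fun τ y => σ * U (-1 + τ) y 2) (τ₀, Γ s₀ + n₀ • νΓ s₀ + z₀ • EuclideanSpace.single 2 (1 : ℝ)) =
        (fderiv ℝ (uncurry R) (τ₀, z₀)).comp
          ((ContinuousLinearMap.fst ℝ ℝ (EuclideanSpace ℝ (Fin 3))).prod
            ((EuclideanSpace.proj (2 : Fin 3)).comp (ContinuousLinearMap.snd ℝ ℝ (EuclideanSpace ℝ (Fin 3))))))
    (hρ : 0 < ρ) (hμ3 : ContDiff ℝ 3 (uncurry μ))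
    (hslabU : ∀ t : ℝ, |t + 1| < ρ → ∀ x : EuclideanSpace ℝ (Fin 3), |x 2| < ρ → ∀ b : Fin 3, b ≠ 2 →
      fderiv ℝ (U t) x (EuclideanSpace.single 2 1) b = μ t (x 2) * fderiv ℝ (U t) x (EuclideanSpace.single b 1) 2)
    (hevU : ∀ t₀ : ℝ, |t₀ + 1| < ρ → ∀ y₀ : EuclideanSpace ℝ (Fin 3), y₀ 2 = 0 →
      ∀ᶠ z in 𝓝 ((t₀, y₀) : ℝ × EuclideanSpace ℝ (Fin 3)), ∀ b : Fin 3, b ≠ 2 →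
        fderiv ℝ (U z.1) z.2 (EuclideanSpace.single 2 1) b = μ z.1 (z.2 2) * fderiv ℝ (U z.1) z.2 (EuclideanSpace.single b 1) 2)
    (hline : ∀ s : ℝ, Γ s = s • deriv Γ 0)
    (hson : ∃ a b : ℝ, ∀ z : ℝ, |z| < δ → R 0 z = a + b * z) (hμ00 : μ (-1) 0 ≠ 0) :
    ∃ (δ'' : ℝ) (n₀ : ℝ × ℝ × ℝ → ℝ), 0 < δ'' ∧ δ'' ≤ δ ∧
      (∀ q : ℝ × ℝ × ℝ, |q.1| < δ'' → |q.2.2| < δ'' →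
        n₀ q ∈ Ioo (-r) r ∧ σ * U (-1 + q.1) (frameCLM (deriv Γ 0) (q.2.1, n₀ q, q.2.2)) 2 = R q.1 q.2.2 ∧ (∀ m : ℕ∞, ContDiffAt ℝ m n₀ q)) ∧
      (∀ s z : ℝ, |z| < δ'' → n₀ ((0 : ℝ), s, z) = n₀ ((0 : ℝ), (0 : ℝ), z)) ∧
      (∀ z : ℝ, |z| < δ'' → deriv (fun z' => n₀ ((0 : ℝ), (0 : ℝ), z')) z ≠ 0) ∧
      (∀ s s' z z₀ : ℝ, |z| < δ'' → |z₀| < δ'' →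
        fderiv ℝ n₀ ((0 : ℝ), s, z) ((1 : ℝ), (0 : ℝ), (0 : ℝ)) - fderiv ℝ n₀ ((0 : ℝ), s', z) ((1 : ℝ), (0 : ℝ), (0 : ℝ)) =
          fderiv ℝ n₀ ((0 : ℝ), s, z₀) ((1 : ℝ), (0 : ℝ), (0 : ℝ)) - fderiv ℝ n₀ ((0 : ℝ), s', z₀) ((1 : ℝ), (0 : ℝ), (0 : ℝ))) := by
  have hm1 : (-1 : ℝ) < 0 := by norm_num
  obtain ⟨δ', n₀, κt, hδ', hδ'δ, hδ'ρ, hδ'h, he2, hunit, hpack, hpar⟩ :=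
    time_web_package_line hUrate hUcont hUmild hUdiv hUpol hUne hUhotbd hσ hσN hκ hΓ0 hΓ2 hΓunit hΓhot hν hΓcurv hr hδ hconc hweb hρ hμ3
      hslabU hevU hline
  set e : EuclideanSpace ℝ (Fin 3) := deriv Γ 0 with he_def
  set d : ℝ → ℝ := fun z => n₀ ((0 : ℝ), (0 : ℝ), z) with hd_def
  /- STEP 1: the slope is negative near `0`, hence the characteristic offset has `d′ ≠ 0`. -/
  have hμfun : μ (-1) = uncurry μ ∘ fun z : ℝ => ((-1 : ℝ), z) := by funext z; rfl
  have hμc : Continuous (μ (-1)) := by rw [hμfun]; exact hμ3.continuous.comp (continuous_const.prodMk continuous_id)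
  have hμle : μ (-1) 0 ≤ 0 :=
    slopeFunction_nonpos hUrate hUcont hUmild hUdiv hUpol hUne hUhotbd hμ3.continuous (hevU (-1) (by simp [hρ]) 0 rfl)
  have hμneg : μ (-1) 0 < 0 := lt_of_le_of_ne hμle hμ00
  obtain ⟨ε, hε, hεμ⟩ : ∃ ε > 0, ∀ z : ℝ, |z| < ε → μ (-1) z < 0 := by
    obtain ⟨ε, hε, h⟩ := Metric.eventually_nhds_iff.1 (hμc.continuousAt.eventually_lt_const hμneg)
    exact ⟨ε, hε, fun z hz => h (by simpa [Real.dist_eq] using hz)⟩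
  set δ'' : ℝ := min δ' ε with hδ''_def
  have hδ'' : 0 < δ'' := lt_min hδ' hε
  have hδ''δ' : δ'' ≤ δ' := min_le_left _ _
  have hδ''ε : δ'' ≤ ε := min_le_right _ _
  have h0' : |(0 : ℝ)| < δ' := by simpa using hδ'
  -- smoothness of `d` and of `n₀` on the window
  have hdd : ∀ z : ℝ, |z| < δ' → DifferentiableAt ℝ d z := by
    intro z hz
    have h := ((hpack ((0 : ℝ), (0 : ℝ), z) h0' hz).2.2.2.2.1 1).differentiableAt (by simp)
    exact h.comp z ((differentiableAt_const _).prodMk ((differentiableAt_const _).prodMk differentiableAt_id))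
  -- `∂_s n₀(0,s,z) = 0` (parallel webs) and `∂_z n₀(0,s,z) = d′(z)`
  have hpin : ∀ s : ℝ, ∀ z ∈ Ioo (-δ'') δ'', n₀ ((0 : ℝ), s, z) = d z := fun s z hz =>
    hpar s z (lt_of_lt_of_le (abs_lt.2 hz) hδ''δ')
  set O : Set (ℝ × ℝ × ℝ) := {q | |q.1| < δ' ∧ |q.2.2| < δ'} with hO_def
  have hOo : IsOpen O := (isOpen_lt (continuous_fst.abs) continuous_const).inter
    (isOpen_lt ((continuous_snd.comp continuous_snd).abs) continuous_const)
  have hG : ContDiffOn ℝ 2 n₀ O := fun q hq => (hpack q hq.1 hq.2).2.2.2.2.1 2 |>.contDiffWithinAt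
  have hG0s : ∀ s : ℝ, ∀ z ∈ Ioo (-δ'') δ'', fderiv ℝ n₀ ((0 : ℝ), s, z) ((0 : ℝ), (1 : ℝ), (0 : ℝ)) = 0 := fun s z hz =>
    fderiv_s_eq_zero_of_pin hOo hG hpin hz ⟨h0', lt_of_lt_of_le (abs_lt.2 hz) hδ''δ'⟩
  have hG0z : ∀ s : ℝ, ∀ z ∈ Ioo (-δ'') δ'', fderiv ℝ n₀ ((0 : ℝ), s, z) ((0 : ℝ), (0 : ℝ), (1 : ℝ)) = deriv d z := fun s z hz =>
    fderiv_z_eq_deriv_of_pin hOo hG isOpen_Ioo hpin (fun z hz => hdd z (lt_of_lt_of_le (abs_lt.2 hz) hδ''δ')) hz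
      ⟨h0', lt_of_lt_of_le (abs_lt.2 hz) hδ''δ'⟩
  /- STEP 2: sonic ⇒ `R″(0,·) = 0` ⇒ `d′² = −μ(−1,·) > 0` on the window. -/
  obtain ⟨a, b, hab⟩ := hson
  have hR'' : ∀ z : ℝ, |z| < δ' → deriv (deriv (R 0)) z = 0 := by
    intro z hz
    have hzδ : |z| < δ := lt_of_lt_of_le hz hδ'δ
    have hev : R 0 =ᶠ[𝓝 z] fun z' => a + b * z' := by
      filter_upwards [(isOpen_lt continuous_abs continuous_const).mem_nhds (hzδ : z ∈ {z' : ℝ | |z'| < δ})] with z' hz' using hab z' hz'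
    have hev1 : deriv (R 0) =ᶠ[𝓝 z] fun _ => b := by
      filter_upwards [hev.eventuallyEq_nhds] with z' hz'
      have hdz : HasDerivAt (fun z'' : ℝ => a + b * z'') b z' := by simpa using ((hasDerivAt_id z').const_mul b).const_add a
      rw [hz'.deriv_eq, hdz.deriv]
    rw [hev1.deriv_eq, deriv_const]
  have hd'sq : ∀ z ∈ Ioo (-δ'') δ'', deriv d z ^ 2 = -μ (-1) z := by
    intro z hz
    have hz' : |z| < δ' := lt_of_lt_of_le (abs_lt.2 hz) hδ''δ'
    obtain ⟨-, -, -, -, -, hκpos, -, hH⟩ := hpack ((0 : ℝ), (0 : ℝ), z) h0' hz'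
    simp only [add_zero] at hH
    rw [hG0z 0 z hz, hG0s 0 z hz, hR'' z hz'] at hH
    have h : κt 0 z * (deriv d z ^ 2 + μ (-1) z) = 0 := by linear_combination hH
    rcases mul_eq_zero.1 h with h1 | h1
    · exact absurd h1 hκpos.ne'
    · linarith
  have hd0 : ∀ z ∈ Ioo (-δ'') δ'', deriv d z ≠ 0 := by
    intro z hz h0
    have h := hd'sq z hz
    rw [h0] at h
    have hμz := hεμ z (lt_of_lt_of_le (abs_lt.2 hz) hδ''ε)
    linarith
  /- STEP 3: the Huygens family in the currency of `…TimeSplit.webSpeed_split` (with `c(τ,z) := κ·(∂_z n₀)²/(1+(∂_s n₀)²)` at `s = 0`). -/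
  obtain ⟨c, hc_def⟩ : ∃ c : ℝ → ℝ → ℝ, c = fun τ z => κt τ z * (fderiv ℝ n₀ (τ, 0, z) ((0 : ℝ), (0 : ℝ), (1 : ℝ))) ^ 2 /
      (1 + (fderiv ℝ n₀ (τ, 0, z) ((0 : ℝ), (1 : ℝ), (0 : ℝ))) ^ 2) := ⟨_, rfl⟩
  have hH : ∀ q ∈ O, κt q.1 q.2.2 * (fderiv ℝ n₀ q ((0 : ℝ), (0 : ℝ), (1 : ℝ))) ^ 2 =
      ((c q.1 q.2.2 + μ (-1 + q.1) q.2.2 * κt q.1 q.2.2) - μ (-1 + q.1) q.2.2 * κt q.1 q.2.2) *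
        (1 + (fderiv ℝ n₀ q ((0 : ℝ), (1 : ℝ), (0 : ℝ))) ^ 2) := by
    intro q hq
    have h1 := (hpack q hq.1 hq.2).2.2.2.2.2.2.2
    have h0 := (hpack (q.1, 0, q.2.2) hq.1 hq.2).2.2.2.2.2.2.2
    simp only at h0
    have hpos : 0 < 1 + (fderiv ℝ n₀ (q.1, 0, q.2.2) ((0 : ℝ), (1 : ℝ), (0 : ℝ))) ^ 2 := by positivity
    have hc : c q.1 q.2.2 = deriv (deriv (R q.1)) q.2.2 - μ (-1 + q.1) q.2.2 * κt q.1 q.2.2 := by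
      rw [hc_def]; simp only
      rw [h0]; field_simp
    rw [h1, hc]; ring
  /- STEP 4: differentiability in `τ` of the coefficients at `τ = 0`. -/
  set T : Set ℝ := Ioo (-1 / 2 : ℝ) (1 / 2) with hT_def
  have hTo : IsOpen T := isOpen_Ioo
  obtain ⟨F, hF_def⟩ : ∃ F : ℝ → EuclideanSpace ℝ (Fin 3) → ℝ, F = fun τ y => σ * U (-1 + τ) y 2 := ⟨_, rfl⟩
  have hFst : IsSmoothSpaceTimeOn T F := by
    have h := contDiffOn_uncurry_signed hUrate hUcont hUmild hUdiv σ (n := ⊤) (T := T) Subset.rfl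
    rw [hF_def]; exact h
  have h0T : (0 : ℝ) ∈ T := ⟨by norm_num, by norm_num⟩
  have hn₀τ : ∀ z : ℝ, |z| < δ' → ∀ v : ℝ × ℝ × ℝ, DifferentiableAt ℝ (fun τ : ℝ => fderiv ℝ n₀ (τ, 0, z) v) 0 := by
    intro z hz v
    have h2 : ContDiffAt ℝ 2 n₀ ((0 : ℝ), (0 : ℝ), z) := (hpack ((0 : ℝ), (0 : ℝ), z) h0' hz).2.2.2.2.1 2
    have hD : DifferentiableAt ℝ (fderiv ℝ n₀) ((0 : ℝ), (0 : ℝ), z) := (h2.fderiv_right (m := 1) le_rfl).differentiableAt (by simp)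
    have hl : DifferentiableAt ℝ (fun τ : ℝ => ((τ, (0 : ℝ), z) : ℝ × ℝ × ℝ)) 0 :=
      differentiableAt_id.prodMk ((differentiableAt_const _).prodMk (differentiableAt_const _))
    exact (hD.comp 0 hl).clm_apply (differentiableAt_const v)
  have hκτ : ∀ z : ℝ, |z| < δ' → DifferentiableAt ℝ (fun τ => κt τ z) 0 := by
    intro z hz
    -- the ridge law gives an explicit formula for `κ(τ,z)` near `τ = 0`
    have hg : DifferentiableAt ℝ (fun τ : ℝ => frameCLM e (0, n₀ (τ, 0, z), z)) 0 := by
      have h1 : DifferentiableAt ℝ (fun τ : ℝ => n₀ (τ, 0, z)) 0 :=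
        (((hpack ((0 : ℝ), (0 : ℝ), z) h0' hz).2.2.2.2.1 1).differentiableAt (by simp)).comp 0
          (differentiableAt_id.prodMk ((differentiableAt_const _).prodMk (differentiableAt_const _)))
      exact (frameCLM e).differentiable.differentiableAt.comp 0 ((differentiableAt_const _).prodMk (h1.prodMk (differentiableAt_const _)))
    have hD := ((differentiableAt_sliceHessian_time hTo hFst h0T hg e e).add (differentiableAt_sliceHessian_time hTo hFst h0T hg (Jvec e) (Jvec e))).neg
    refine hD.congr_of_eventuallyEq ?_
    filter_upwards [(isOpen_lt continuous_abs continuous_const).mem_nhds (h0' : (0 : ℝ) ∈ {τ : ℝ | |τ| < δ'})] with τ hτ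
    have h := (hpack (τ, 0, z) hτ hz).2.2.2.2.2.2.1
    simp only at h
    rw [hF_def]; simp only [Pi.neg_apply, Pi.add_apply]
    linarith
  have hμτ : ∀ z : ℝ, DifferentiableAt ℝ (fun τ => μ (-1 + τ) z) 0 := by
    intro z
    have h : DifferentiableAt ℝ (uncurry μ ∘ fun τ : ℝ => ((-1 + τ, z) : ℝ × ℝ)) 0 :=
      ((hμ3.differentiable (by norm_num)) _).comp 0 (((differentiableAt_const _).add differentiableAt_id).prodMk (differentiableAt_const _))
    exact h
  have hcτ : ∀ z : ℝ, |z| < δ' → DifferentiableAt ℝ (fun τ => c τ z) 0 := by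
    intro z hz
    rw [hc_def]; simp only
    refine ((hκτ z hz).mul ((hn₀τ z hz _).pow 2)).div ((hn₀τ z hz _).pow 2 |>.const_add 1) ?_
    positivity
  have hR2τ : ∀ z : ℝ, |z| < δ' → DifferentiableAt ℝ (fun τ => c τ z + μ (-1 + τ) z * κt τ z) 0 := fun z hz =>
    (hcτ z hz).add ((hμτ z).mul (hκτ z hz))
  /- STEP 5: the split. -/
  refine ⟨δ'', n₀, hδ'', hδ''δ'.trans hδ'δ, fun q h1 h2 => ?_, fun s z hz => hpar s z (lt_of_lt_of_le hz hδ''δ'),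
    fun z hz => hd0 z (abs_lt.1 hz |> fun h => ⟨h.1, h.2⟩), fun s s' z z₀ hz hz₀ => ?_⟩
  · obtain ⟨hin, hval, -, -, hCm, -⟩ := hpack q (lt_of_lt_of_le h1 hδ''δ') (lt_of_lt_of_le h2 hδ''δ')
    exact ⟨hin, hval, hCm⟩
  · have hzI : z ∈ Ioo (-δ'') δ'' := ⟨(abs_lt.1 hz).1, (abs_lt.1 hz).2⟩
    have hz₀I : z₀ ∈ Ioo (-δ'') δ'' := ⟨(abs_lt.1 hz₀).1, (abs_lt.1 hz₀).2⟩
    exact webSpeed_split (κ := κt) (R2 := fun τ z => c τ z + μ (-1 + τ) z * κt τ z) (μ := fun τ z => μ (-1 + τ) z) hOo hG rfl hpin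
      (fun z hz => hdd z (lt_of_lt_of_le (abs_lt.2 hz) hδ''δ')) hH
      (fun z hz => ((hpack ((0 : ℝ), (0 : ℝ), z) h0' (lt_of_lt_of_le (abs_lt.2 hz) hδ''δ')).2.2.2.2.2.1).ne') hd0
      (fun z hz => hκτ z (lt_of_lt_of_le (abs_lt.2 hz) hδ''δ')) (fun z hz => hR2τ z (lt_of_lt_of_le (abs_lt.2 hz) hδ''δ'))
      (fun z hz => hμτ z)
      (fun z hz => ⟨h0', lt_of_lt_of_le (abs_lt.2 hz) hδ''δ'⟩) (fun z hz => ⟨h0', lt_of_lt_of_le (abs_lt.2 hz) hδ''δ'⟩) hzI hz₀I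

end Summit.NavierStokesRegularity.NavierStokesRegularity.Theorems.PoloidalWindowDoorLrcModEntireQ4SonicTimeSplitClass

end
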